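import Literature.NumberTheory.LFunctions.WeilGroundState
import Literature.NumberTheory.LFunctions.WeilSmallSupportPositivity
import Summits.RiemannHypothesis.RiemannHypothesis.Theorems.WeilWindowFlowStrictUnderRHZeroSide
import HarnessLib

/-!
# Strict antitonicity of the window bottom — II: translates of a ground state are independent
(crux stmt-RiemannHypothesis-1037 `GronwallLeakage`, route WeilWindowFlow; line `Sketch`, lead c6)

Second toolkit file for `ε(A) < ε(a)` (`0 < a < A`). A ground state `u` of a window (`L²`-limit of a
normalised minimising sequence, `IsWeilGroundState a u`) is a non-zero compactly supported `L²`
function, so its translates are linearly independent; quantitatively and uniformly along any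
sequence of test functions `gₙ → u` in `L²`:

* `weilMellin_translate` — `(u(· + h))^(s) = e^{-(s - 1/2) h} û(s)`;
* `eq_zero_of_sum_translates_ae_eq_zero` — if a real combination `Σ_{j<m} c_j u(· + j d)` (`d ≠ 0`)
  of equally spaced translates vanishes a.e., then `c = 0`: its transform is `P(s) û(s)` with
  `P(s) = Σ_j c_j e^{-(s-1/2) j d}` entire; `û` is entire and not identically zero
  (`exists_weilMellin_half_line_ne_zero`), so `P ≡ 0` (identity theorem), i.e. the real polynomial
  `Σ_j c_j X^j` vanishes on `(0, ∞)`, hence is zero;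
* `exists_norm_sq_le_integral_sum_translates` — the uniform lower bound: there is `κ > 0` such that
  for all large `n` and every `c : Fin m → ℝ`,
  `κ ‖c‖² ≤ ∫ |Σ_j c_j gₙ(t + j d)|² dt` (injective linear map from `ℝ^m` into `L²` is bounded below,
  `LinearMap.exists_antilipschitzWith`; stability under the perturbation `gₙ → u`).

Axioms ⊆ {propext, Classical.choice, Quot.sound}.
-/

-- `Summit.RiemannHypothesis.RiemannHypothesis.…` repeats a namespace component by design (D-0017 layout).
set_option linter.dupNamespace false

noncomputable section

open MeasureTheory Set Filter Complex
open scoped Topology ComplexConjugate BigOperators ENNReal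

namespace Summit.RiemannHypothesis.RiemannHypothesis.Theorems.WeilWindowFlowGronwallLeakage

open Literature.NumberTheory.LFunctions
open Summit.RiemannHypothesis.RiemannHypothesis.Theorems.WeilWindowFlowStrictUnderRH
  (exists_weilMellin_half_line_ne_zero)

/-! ## Mellin transform of translates -/

/-- **Transform of a translate**: `(f(· + h))^(s) = e^{-(s - 1/2) h} f̂(s)` (substitution
`t ↦ t - h`; no hypotheses). [folklore] -/
theorem weilMellin_translate (f : ℝ → ℂ) (h : ℝ) (s : ℂ) :
    weilMellin (fun t ↦ f (t + h)) s = cexp (-((s - 1 / 2) * h)) * weilMellin f s := by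
  unfold weilMellin
  have key := integral_add_right_eq_self (μ := (volume : Measure ℝ))
    (fun t : ℝ ↦ f t * cexp ((s - 1 / 2) * (t - h : ℝ))) h
  simp only [add_sub_cancel_right] at key
  rw [key, ← integral_const_mul]
  congr 1 with t
  rw [show ((t - h : ℝ) : ℂ) = (t : ℂ) - (h : ℂ) by push_cast; ring, mul_sub, sub_eq_add_neg,
    Complex.exp_add]
  ring

/-- The integrand of the transform of a translate of `u` is integrable when all exponential moments
of `u` are. [folklore] -/
theorem integrable_translate_mul_cexp {u : ℝ → ℂ}
    (hint : ∀ c : ℂ, Integrable fun t : ℝ ↦ u t * cexp (c * t)) (h : ℝ) (c : ℂ) :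
    Integrable fun t : ℝ ↦ u (t + h) * cexp (c * t) := by
  have h1 := (hint c).comp_add_right h
  have e : (fun t : ℝ ↦ u (t + h) * cexp (c * t)) =
      fun t ↦ cexp (-(c * h)) * (u (t + h) * cexp (c * ((t + h : ℝ) : ℂ))) := by
    funext t
    rw [show ((t + h : ℝ) : ℂ) = (t : ℂ) + (h : ℂ) by push_cast; ring]
    rw [mul_add, Complex.exp_add]
    have : cexp (-(c * h)) * cexp (c * h) = 1 := by rw [← Complex.exp_add]; simp
    linear_combination (-(u (t + h) * cexp (c * ↑t))) * this
  rw [e]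
  exact h1.const_mul _

/-- **Transform of a real combination of translates**:
`(Σ_j c_j u(· + h_j))^(s) = (Σ_j c_j e^{-(s-1/2) h_j}) · û(s)`. [folklore] -/
theorem weilMellin_sum_translates {u : ℝ → ℂ}
    (hint : ∀ c : ℂ, Integrable fun t : ℝ ↦ u t * cexp (c * t)) {m : ℕ} (c : Fin m → ℝ)
    (h : Fin m → ℝ) (s : ℂ) :
    weilMellin (fun t ↦ ∑ j, (c j : ℂ) * u (t + h j)) s =
      (∑ j, (c j : ℂ) * cexp (-((s - 1 / 2) * h j))) * weilMellin u s := by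
  unfold weilMellin
  have hI : ∀ j ∈ (Finset.univ : Finset (Fin m)),
      Integrable fun t : ℝ ↦ (c j : ℂ) * (u (t + h j) * cexp ((s - 1 / 2) * t)) :=
    fun j _ ↦ (integrable_translate_mul_cexp hint (h j) (s - 1 / 2)).const_mul _
  have e : (fun t : ℝ ↦ (∑ j, (c j : ℂ) * u (t + h j)) * cexp ((s - 1 / 2) * t)) =
      fun t ↦ ∑ j, (c j : ℂ) * (u (t + h j) * cexp ((s - 1 / 2) * t)) := by
    funext t
    rw [Finset.sum_mul]
    refine Finset.sum_congr rfl fun j _ ↦ ?_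
    ring
  rw [e, integral_finsetSum _ hI, Finset.sum_mul]
  refine Finset.sum_congr rfl fun j _ ↦ ?_
  rw [integral_const_mul]
  have := weilMellin_translate u (h j) s
  unfold weilMellin at this
  rw [this]
  ring

/-! ## Linear independence of equally spaced translates of a ground state -/

/-- The exponential sum `P(s) = Σ_j c_j e^{-(s-1/2) j d}` attached to real coefficients `c` and a
step `d`, evaluated at `s = 1/2 + z` with `z` real, is the real polynomial `Σ_j c_j X^j` at
`X = e^{-z d}`. [folklore] -/
theorem expSum_eq_polynomial_eval {m : ℕ} (c : Fin m → ℝ) (d z : ℝ) :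
    (∑ j : Fin m, (c j : ℂ) * cexp (-((((1 / 2 : ℂ) + z) - 1 / 2) * ((j : ℕ) * d : ℝ)))) =
      ((∑ j : Fin m, Polynomial.C (c j) * Polynomial.X ^ (j : ℕ)).eval (Real.exp (-(z * d))) : ℝ) := by
  rw [Polynomial.eval_finsetSum]
  push_cast
  refine Finset.sum_congr rfl fun j _ ↦ ?_
  rw [Polynomial.eval_mul, Polynomial.eval_C, Polynomial.eval_pow, Polynomial.eval_X]
  push_cast
  congr 1
  rw [← Complex.exp_nat_mul]
  congr 1
  ring

/-- **Equally spaced translates of a ground state are linearly independent over `ℝ`**: if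
`Σ_{j<m} c_j u(· + j d) = 0` a.e. with `d ≠ 0`, then `c = 0`. [folklore] -/
theorem eq_zero_of_sum_translates_ae_eq_zero {a : ℝ} {u : ℝ → ℂ} (hu : IsWeilGroundState a u)
    {m : ℕ} {d : ℝ} (hd : d ≠ 0) (c : Fin m → ℝ)
    (h0 : (fun t ↦ ∑ j : Fin m, (c j : ℂ) * u (t + (j : ℕ) * d)) =ᵐ[volume] 0) : c = 0 := by
  -- the transform of the combination vanishes identically
  have hM : ∀ s : ℂ, (∑ j : Fin m, (c j : ℂ) * cexp (-((s - 1 / 2) * ((j : ℕ) * d : ℝ)))) *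
      weilMellin u s = 0 := by
    intro s
    rw [← weilMellin_sum_translates hu.integrable_mul_cexp c (fun j : Fin m ↦ ((j : ℕ) * d : ℝ)) s]
    unfold weilMellin
    rw [← integral_zero ℝ ℂ]
    refine integral_congr_ae ?_
    filter_upwards [h0] with t ht
    simp only [Pi.zero_apply] at ht
    simp only [ht, zero_mul]
  -- the exponential sum `P`
  set P : ℂ → ℂ := fun s ↦ ∑ j : Fin m, (c j : ℂ) * cexp (-((s - 1 / 2) * ((j : ℕ) * d : ℝ)))
    with hPdef
  have hPd : Differentiable ℂ P := by
    simp only [hPdef]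
    fun_prop
  have hPan : AnalyticOnNhd ℂ P univ := (hPd.differentiableOn (s := univ)).analyticOnNhd isOpen_univ
  -- `û` does not vanish identically, hence not near some `s₀`; there `P = 0`
  obtain ⟨ξ, hξ⟩ := exists_weilMellin_half_line_ne_zero hu
  set s₀ : ℂ := 1 / 2 + (ξ : ℂ) * I with hs₀
  have hcont : ContinuousAt (weilMellin u) s₀ := (hu.differentiable_weilMellin s₀).continuousAt
  have hne : ∀ᶠ s in 𝓝 s₀, weilMellin u s ≠ 0 := hcont.eventually_ne hξ
  have hP0 : P =ᶠ[𝓝 s₀] 0 := by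
    filter_upwards [hne] with s hs
    have := hM s
    simp only [hPdef, Pi.zero_apply]
    exact (mul_eq_zero.1 this).resolve_right hs
  have hPzero : EqOn P 0 univ :=
    hPan.eqOn_zero_of_preconnected_of_eventuallyEq_zero isPreconnected_univ (mem_univ s₀) hP0
  -- the real polynomial `Σ c_j X^j` vanishes on `(0, ∞)`
  set p : Polynomial ℝ := ∑ j : Fin m, Polynomial.C (c j) * Polynomial.X ^ (j : ℕ) with hpdef
  have hroots : ∀ x : ℝ, 0 < x → p.IsRoot x := by
    intro x hx
    have hz := hPzero (mem_univ ((1 / 2 : ℂ) + ((-(Real.log x) / d : ℝ) : ℂ)))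
    simp only [hPdef, Pi.zero_apply] at hz
    rw [expSum_eq_polynomial_eval c d] at hz
    have hx' : Real.exp (-(-(Real.log x) / d * d)) = x := by
      rw [div_mul_cancel₀ _ hd, neg_neg, Real.exp_log hx]
    rw [hx'] at hz
    exact_mod_cast hz
  have hp : p = 0 := by
    refine Polynomial.eq_zero_of_infinite_isRoot p ?_
    exact (Set.Ioi_infinite (0 : ℝ)).mono fun x hx ↦ hroots x hx
  -- read off the coefficients
  funext i
  have hcoeff : p.coeff (i : ℕ) = c i := by
    simp only [hpdef, Polynomial.finsetSum_coeff, Polynomial.coeff_C_mul_X_pow]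
    rw [Finset.sum_eq_single i]
    · simp
    · intro j _ hji
      rw [if_neg]
      exact fun h ↦ hji (Fin.ext h.symm)
    · simp
  rw [← hcoeff, hp, Polynomial.coeff_zero]
  rfl

/-! ## The `L²` lower bound, uniformly along a sequence `gₙ → u` -/

/-- Translation preserves square integrability. [folklore] -/
theorem memLp_translate {f : ℝ → ℂ} (hf : MemLp f 2 volume) (h : ℝ) :
    MemLp (fun t ↦ f (t + h)) 2 volume :=
  hf.comp_measurePreserving (measurePreserving_add_right volume h)

/-- `‖f‖_{L²} = √(∫ ‖f‖²)` for the `Lp` class of a square integrable `f`. [folklore] -/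
theorem norm_toLp_eq_sqrt {f : ℝ → ℂ} (hf : MemLp f 2 volume) :
    ‖hf.toLp f‖ = Real.sqrt (∫ t, ‖f t‖ ^ 2) := by
  rw [Lp.norm_toLp, eLpNorm_two_eq_ofReal_sqrt hf, ENNReal.toReal_ofReal (Real.sqrt_nonneg _)]

/-- A finite real combination of square integrable functions is square integrable. [folklore] -/
theorem memLp_sum_real_mul {m : ℕ} {F : Fin m → ℝ → ℂ} (hF : ∀ j, MemLp (F j) 2 volume)
    (c : Fin m → ℝ) : MemLp (fun t ↦ ∑ j, (c j : ℂ) * F j t) 2 volume :=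
  memLp_finsetSum _ fun j _ ↦ (hF j).const_mul (c j : ℂ)

/-- Almost-everywhere form of a finite real combination in `L²`. [folklore] -/
theorem coeFn_sum_smul {m : ℕ} (c : Fin m → ℝ) (x : Fin m → Lp ℂ 2 (volume : Measure ℝ)) :
    ⇑(∑ j, c j • x j) =ᵐ[volume] fun t ↦ ∑ j, (c j : ℂ) * (x j) t := by
  suffices h : ∀ s : Finset (Fin m),
      ⇑(∑ j ∈ s, c j • x j) =ᵐ[volume] fun t ↦ ∑ j ∈ s, (c j : ℂ) * (x j) t from h Finset.univ
  intro s
  classical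
  induction s using Finset.induction_on with
  | empty =>
    simp only [Finset.sum_empty]
    filter_upwards [Lp.coeFn_zero ℂ 2 (volume : Measure ℝ)] with t ht
    simp
  | insert i s hi ih =>
    rw [Finset.sum_insert hi]
    filter_upwards [Lp.coeFn_add (c i • x i) (∑ j ∈ s, c j • x j), Lp.coeFn_smul (c i) (x i), ih]
      with t h1 h2 h3
    rw [h1, Pi.add_apply, h2, Pi.smul_apply, h3, Finset.sum_insert hi, Complex.real_smul]

/-- The `Lp` class of a finite real combination is the combination of the `Lp` classes. [folklore] -/
theorem sum_smul_toLp_eq {m : ℕ} {F : Fin m → ℝ → ℂ} (hF : ∀ j, MemLp (F j) 2 volume)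
    (c : Fin m → ℝ) :
    ∑ j, c j • (hF j).toLp (F j) = (memLp_sum_real_mul hF c).toLp _ := by
  refine Lp.ext ?_
  have h1 := coeFn_sum_smul c (fun j ↦ (hF j).toLp (F j))
  have h2 : ∀ᵐ t ∂(volume : Measure ℝ), ∀ j, ((hF j).toLp (F j)) t = F j t := by
    rw [ae_all_iff]
    exact fun j ↦ (hF j).coeFn_toLp
  filter_upwards [h1, h2, (memLp_sum_real_mul hF c).coeFn_toLp] with t ht ht2 ht3
  rw [ht, ht3]
  exact Finset.sum_congr rfl fun j _ ↦ by rw [ht2 j]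

/-- `∫ |Σ_j c_j F_j|² = ‖Σ_j c_j [F_j]‖²_{L²}`. [folklore] -/
theorem integral_norm_sq_sum_eq {m : ℕ} {F : Fin m → ℝ → ℂ} (hF : ∀ j, MemLp (F j) 2 volume)
    (c : Fin m → ℝ) :
    ∫ t, ‖∑ j, (c j : ℂ) * F j t‖ ^ 2 = ‖∑ j, c j • (hF j).toLp (F j)‖ ^ 2 := by
  rw [sum_smul_toLp_eq hF c, norm_toLp_eq_sqrt,
    Real.sq_sqrt (integral_nonneg fun t ↦ by positivity)]

/-- **Translates of a ground state are uniformly independent in `L²`**: for `d ≠ 0` there is `K > 0`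
with `‖c‖ ≤ K ‖Σ_{j<m} c_j [u(· + j d)]‖_{L²}` for all real `c` (an injective linear map out of a
finite-dimensional space is bounded below, `LinearMap.exists_antilipschitzWith`). [folklore] -/
theorem exists_norm_le_mul_norm_sum_translates {a : ℝ} {u : ℝ → ℂ} (hu : IsWeilGroundState a u)
    (m : ℕ) {d : ℝ} (hd : d ≠ 0) :
    ∃ K : ℝ, 0 < K ∧ ∀ c : Fin m → ℝ,
      ‖c‖ ≤ K * ‖∑ j : Fin m, c j •
        (memLp_translate hu.memLp ((j : ℕ) * d)).toLp (fun t ↦ u (t + (j : ℕ) * d))‖ := by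
  set U : Fin m → Lp ℂ 2 (volume : Measure ℝ) := fun j ↦
    (memLp_translate hu.memLp ((j : ℕ) * d)).toLp (fun t ↦ u (t + (j : ℕ) * d)) with hU
  set L : (Fin m → ℝ) →ₗ[ℝ] Lp ℂ 2 (volume : Measure ℝ) :=
    ∑ j : Fin m, (LinearMap.proj j : (Fin m → ℝ) →ₗ[ℝ] ℝ).smulRight (U j) with hL
  have hLc : ∀ c : Fin m → ℝ, L c = ∑ j, c j • U j := by
    intro c
    simp [hL, LinearMap.sum_apply, LinearMap.smulRight_apply]
  have hker : LinearMap.ker L = ⊥ := by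
    refine LinearMap.ker_eq_bot'.2 fun c hc ↦ ?_
    rw [hLc, hU, sum_smul_toLp_eq (fun j ↦ memLp_translate hu.memLp ((j : ℕ) * d)) c] at hc
    have hae : (fun t ↦ ∑ j : Fin m, (c j : ℂ) * u (t + (j : ℕ) * d)) =ᵐ[volume] 0 := by
      rw [← (MemLp.zero' (ε := ℂ) (p := (2 : ℝ≥0∞)) (μ := (volume : Measure ℝ))).toLp_zero,
        MemLp.toLp_eq_toLp_iff] at hc
      exact hc
    exact eq_zero_of_sum_translates_ae_eq_zero hu hd c hae
  obtain ⟨K, hK, hanti⟩ := L.exists_antilipschitzWith hker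
  refine ⟨K, by exact_mod_cast hK, fun c ↦ ?_⟩
  have h := hanti.le_mul_dist c 0
  rwa [dist_zero_right, map_zero, dist_zero_right, hLc] at h

/-- **Uniform `L²`-independence of translates along `gₙ → u`**: for a ground state `u`, square
integrable `gₙ` with `∫ |gₙ - u|² → 0`, `m` and `d ≠ 0`, there is `κ > 0` such that for all large
`n` and all real `c`, `κ ‖c‖² ≤ ∫ |Σ_{j<m} c_j gₙ(t + j d)|² dt`. [folklore] -/
theorem exists_norm_sq_le_integral_sum_translates {a : ℝ} {u : ℝ → ℂ} (hu : IsWeilGroundState a u)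
    {g : ℕ → ℝ → ℂ} (hg : ∀ n, MemLp (g n) 2 volume)
    (hL2 : Tendsto (fun n ↦ ∫ t, ‖g n t - u t‖ ^ 2) atTop (𝓝 0)) (m : ℕ) {d : ℝ} (hd : d ≠ 0) :
    ∃ κ : ℝ, 0 < κ ∧ ∀ᶠ n in atTop, ∀ c : Fin m → ℝ,
      κ * ‖c‖ ^ 2 ≤ ∫ t, ‖∑ j : Fin m, (c j : ℂ) * g n (t + (j : ℕ) * d)‖ ^ 2 := by
  obtain ⟨K, hK, hKc⟩ := exists_norm_le_mul_norm_sum_translates hu m hd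
  -- `dₙ = ‖gₙ - u‖₂ → 0`
  have hd_n : Tendsto (fun n ↦ Real.sqrt (∫ t, ‖g n t - u t‖ ^ 2)) atTop (𝓝 0) := by
    simpa using hL2.sqrt
  have hε₀ : 0 < 1 / (2 * K * (m + 1)) := by positivity
  have hev : ∀ᶠ n in atTop, Real.sqrt (∫ t, ‖g n t - u t‖ ^ 2) < 1 / (2 * K * (m + 1)) :=
    (tendsto_order.1 hd_n).2 _ hε₀
  refine ⟨1 / (4 * K ^ 2), by positivity, ?_⟩
  filter_upwards [hev] with n hn c
  set dn : ℝ := Real.sqrt (∫ t, ‖g n t - u t‖ ^ 2) with hdn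
  have hdn0 : 0 ≤ dn := Real.sqrt_nonneg _
  -- the `Lp` classes of the translates
  set U : Fin m → Lp ℂ 2 (volume : Measure ℝ) := fun j ↦
    (memLp_translate hu.memLp ((j : ℕ) * d)).toLp (fun t ↦ u (t + (j : ℕ) * d)) with hU
  set x : Fin m → Lp ℂ 2 (volume : Measure ℝ) := fun j ↦
    (memLp_translate (hg n) ((j : ℕ) * d)).toLp (fun t ↦ g n (t + (j : ℕ) * d)) with hx
  -- each translate class is within `dₙ` of the corresponding class of `u`
  have hdist : ∀ j, ‖x j - U j‖ = dn := by
    intro j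
    rw [hx, hU, ← MemLp.toLp_sub, norm_toLp_eq_sqrt, hdn]
    congr 1
    exact integral_norm_sq_translate (fun t ↦ g n t - u t) ((j : ℕ) * d)
  -- lower bound for the combination of the `x j`
  have h1 : ‖c‖ ≤ K * ‖∑ j, c j • U j‖ := hKc c
  have h2 : ‖∑ j, c j • (x j - U j)‖ ≤ m * ‖c‖ * dn := by
    calc ‖∑ j, c j • (x j - U j)‖ ≤ ∑ j, ‖c j • (x j - U j)‖ := norm_sum_le _ _
      _ = ∑ j, |c j| * dn := Finset.sum_congr rfl fun j _ ↦ by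
          rw [norm_smul, Real.norm_eq_abs, hdist]
      _ ≤ ∑ _j : Fin m, ‖c‖ * dn := Finset.sum_le_sum fun j _ ↦ by
          have : |c j| ≤ ‖c‖ := by simpa using norm_le_pi_norm c j
          exact mul_le_mul_of_nonneg_right this hdn0
      _ = m * ‖c‖ * dn := by simp [Finset.sum_const, mul_assoc]
  have hsplit : ∑ j, c j • x j = ∑ j, c j • U j + ∑ j, c j • (x j - U j) := by
    rw [← Finset.sum_add_distrib]
    refine Finset.sum_congr rfl fun j _ ↦ ?_
    rw [smul_sub, add_sub_cancel]
  have h3 : ‖∑ j, c j • U j‖ - ‖∑ j, c j • (x j - U j)‖ ≤ ‖∑ j, c j • x j‖ := by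
    have := norm_add_le (∑ j, c j • x j) (-(∑ j, c j • (x j - U j)))
    rw [norm_neg] at this
    have e : ∑ j, c j • x j + -∑ j, c j • (x j - U j) = ∑ j, c j • U j := by
      rw [hsplit]; abel
    rw [e] at this
    linarith
  -- `m dₙ ≤ 1/(2K)`
  have h4 : m * ‖c‖ * dn ≤ ‖c‖ / (2 * K) := by
    have hm : (m : ℝ) * dn ≤ (m + 1) * (1 / (2 * K * (m + 1))) := by
      have : (m : ℝ) ≤ m + 1 := by linarith
      nlinarith [hn.le, hdn0]
    have hm' : (m + 1 : ℝ) * (1 / (2 * K * (m + 1))) = 1 / (2 * K) := by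
      field_simp
    calc (m : ℝ) * ‖c‖ * dn = ‖c‖ * (m * dn) := by ring
      _ ≤ ‖c‖ * (1 / (2 * K)) := mul_le_mul_of_nonneg_left (hm.trans_eq hm') (norm_nonneg _)
      _ = ‖c‖ / (2 * K) := by ring
  have h5 : ‖c‖ / (2 * K) ≤ ‖∑ j, c j • x j‖ := by
    have : ‖c‖ / K ≤ ‖∑ j, c j • U j‖ := by
      rw [div_le_iff₀ hK]; linarith
    have hK2 : ‖c‖ / K - ‖c‖ / (2 * K) = ‖c‖ / (2 * K) := by field_simp; ring
    linarith
  -- square and translate back to the integral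
  rw [integral_norm_sq_sum_eq (fun j ↦ memLp_translate (hg n) ((j : ℕ) * d)) c]
  have h6 : 1 / (4 * K ^ 2) * ‖c‖ ^ 2 = (‖c‖ / (2 * K)) ^ 2 := by field_simp; ring
  rw [h6]
  exact pow_le_pow_left₀ (by positivity) h5 2

/-- **Headline (registered sub-goal of crux stmt-RiemannHypothesis-1037, line `Sketch`).** Closed form of
`exists_norm_sq_le_integral_sum_translates`: along any square integrable sequence `gₙ → u` in `L²`
towards a ground state `u`, the `m` equally spaced translates of `gₙ` (step `d ≠ 0`) are uniformly
linearly independent in `L²` for all large `n`. [folklore] -/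
theorem translates_uniformly_independent :
    ∀ (a : ℝ) (u : ℝ → ℂ) (g : ℕ → ℝ → ℂ) (m : ℕ) (d : ℝ), IsWeilGroundState a u →
      (∀ n, MemLp (g n) 2 volume) → Tendsto (fun n ↦ ∫ t, ‖g n t - u t‖ ^ 2) atTop (𝓝 0) →
      d ≠ 0 → ∃ κ : ℝ, 0 < κ ∧ ∀ᶠ n in atTop, ∀ c : Fin m → ℝ,
        κ * ‖c‖ ^ 2 ≤ ∫ t, ‖∑ j : Fin m, (c j : ℂ) * g n (t + (j : ℕ) * d)‖ ^ 2 :=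
  fun _ _ _ m _ hu hg hL2 hd ↦ exists_norm_sq_le_integral_sum_translates hu hg hL2 m hd

end Summit.RiemannHypothesis.RiemannHypothesis.Theorems.WeilWindowFlowGronwallLeakage

end
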